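import Mathlib
import HarnessLib
import Summits.HubbardSuperconductivity.HubbardSuperconductivity.Theorems.KLProgrammeC4aFoldBoxPreLawLine
import Summits.HubbardSuperconductivity.HubbardSuperconductivity.Theorems.KLProgrammeC4aPreCausticLevelLineSplitAbs

/-!
# Route `KLProgramme` — crux C4a, S3 brick (B4) «(U1)-LAWS» part 5c′: the PRE-CAUSTIC LEVEL LINE OF THE ACTUAL PARTNER BAND at one loop angle — PRIMED SIBLING:
# two-sided split support `|u| ≤ q_s·e` ((L2′)) and a flatness slot `A_fl·lo/max(D,lo)² + B_fl` ((L1′))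

Cell `gate-hubbard-kl`, seat hubbard-kl-k3c3-p3 (g33; row «implicit-function / monotonicity route for μ(n)»).  Located brick for the (C)-closer lane / the (M4)
assembly of the umklapp first-order ϑ-layer (stub (C) `stub_twoLeg_curvature` of `KLRegimeEngineV17F2`, stmt-HubbardSuperconductivity-20437), memo
HOME/hubbard-kl-k3c3-p3/U1-CAUSTIC-SUP.md §15; pen rulings (R319)(E)/(R321)(B) («RE-QUANTIFICATION = GO as PRIMED SIBLINGS»; owner split: k3c3-p1 the
two-sided Split law `…C4aPreCausticLevelLineSplitAbs` + the kernel bundle, k3c3-p3 the chain above it).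

WHY.  k3c3-p1's located rows (L1)/(L2) (KL STATUS 2026-08-29 01:45Z/02:05Z): no `n`-free PHYSICAL kernel family meets the unprimed binders (i) `hsupp : ∀ u ≤ q_s·e`
(a genuine finer-line partition piece is alive again at `u < −c·e`) and (ii) `hflat : ∀ D > 0, ≤ A_fl·lo/max(D,lo)²` (for `D` beyond the box height the
box-truncated flatness integral is `≍ W·hi/D²`, and a Lipschitz `e`-weight leaves an additive `B_fl`).  The proofs never needed either in that strength: the support
row is evaluated only on `u ≥ −3e/2` (this is `…SplitAbs`), and the flatness row only AT `D = e_K(S − Φ(0,y+θ))`, the level-`0` partner band at the loop angle `y`.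
This file re-runs part 5c's proof verbatim against the two-sided Split law, with the flatness number replaced by the slot `A_fl·lo/max(D,lo)² + B_fl`, and adds
the one-line geometric fact that bounds the needed `D`-range upstream.
* §1 **`partnerBand_level_le_mul_norm_caustic`**: `e_K(S − Φ(0,ψ)) ≤ K₁·‖S − 2πm − 2Φ(0,ψ)‖` (Fermi curve + periodicity + `K₁`-Lipschitz).
* §2 **`abs_levelLine_partnerBand_pre_le'`** (HEADLINE): part 5c's `abs_levelLine_partnerBand_pre_le` with `hqs : 3/2 ≤ q_s`,
  `hsupp : |u| ≤ q_s·e → (K e)′u = 0`, `hflat : … ≤ A_fl·lo/max(D,lo)² + B_fl`, conclusion `… + X₀·B_fl` (the `A₃` slot of the (N2) angle layer).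
Sizes binder shape + `GeomConstants`; nothing asserts (C), K3 or superconductivity.
References: FST II CPAM 51 (1998) §3 [cite: FeldmanSalmhoferTrubowitz1998]; Salmhofer 1999 §4.5.3 [cite: Salmhofer1999].
-/

noncomputable section

namespace Summit.HubbardSuperconductivity.HubbardSuperconductivity.Theorems.C4a

set_option linter.dupNamespace false -- summit = problem name (single-conjunct summit), D-0017

open Real Set MeasureTheory intervalIntegral
open Literature.MathematicalPhysics.QuantumLattice Literature.MathematicalPhysics.QuantumLattice.BandSectorCounting
open Literature.MathematicalPhysics.QuantumLattice.FermiRG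
open Summit.HubbardSuperconductivity.HubbardSuperconductivity.Theorems.KLRegimeSplit
open Summit.HubbardSuperconductivity.HubbardSuperconductivity.Theorems.DispersionFlow
open Summit.HubbardSuperconductivity.HubbardSuperconductivity.Theorems.PerturbedFermiCurve

section Sizes

variable {K : TrigPolyC4v} {A : ℝ} (hA : ∀ p : Momentum, ∀ j ≤ 2, ‖iteratedFDeriv ℝ j (frameShift K) p‖ ≤ A) (hA20 : A ≤ 1 / 20)
  (hd : klCurveD ≤ (bandBounds (show (-4 : ℝ) < -1.1 by norm_num) (show (-1.1 : ℝ) ≤ -0.1 by norm_num)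
    (show (-0.1 : ℝ) < 0 by norm_num)).Dtmin - 2 * A)
  {μ r : ℝ} (hr : 0 < r) (hlo : (-1.1 : ℝ) < μ - r - A) (hhi : μ + r + A < -0.1)
  {A₃ A₄ : ℝ} (hA₃ : ∀ p : Momentum, ‖iteratedFDeriv ℝ 3 (frameShift K) p‖ ≤ A₃)
  (hA₄ : ∀ p : Momentum, ‖iteratedFDeriv ℝ 4 (frameShift K) p‖ ≤ A₄)
  {K₁ K₂ K₃ : ℝ} (hK₁ : ∀ p : Momentum, ‖fderiv ℝ (frameLevel μ K) p‖ ≤ K₁) (hK₂ : ∀ p : Momentum, ‖iteratedFDeriv ℝ 2 (frameLevel μ K) p‖ ≤ K₂)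
  (hK₃ : ∀ p : Momentum, ‖iteratedFDeriv ℝ 3 (frameLevel μ K) p‖ ≤ K₃)
include hA hA20 hd hr hlo hhi hA₃ hA₄ hK₁ hK₂ hK₃

/-! ## §1 The level-0 partner band is dominated by the caustic distance -/

omit hA20 hd hA₃ hA₄ hK₂ hK₃ in
/-- **THE LEVEL-0 PARTNER BAND IS AT MOST `K₁ ×` THE CAUSTIC DISTANCE**: `e_K(S − Φ(0,ψ)) ≤ K₁·‖S − 2πm − 2Φ(0,ψ)‖` — `e_K(Φ(0,ψ) + 2πm) = 0` (the level-`0`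
chart curve is the Fermi curve, `e_K` is `2πℤ²`-periodic) and `e_K` is `K₁`-Lipschitz, while `(S − Φ(0,ψ)) − (Φ(0,ψ) + 2πm)` is the caustic vector.  This is what
bounds the range of anti-diagonal levels `D` at which the flatness row is ever used on a near-caustic box (`D ≤ K₁·Δ`, (L1′) of record). -/
theorem partnerBand_level_le_mul_norm_caustic (S : Momentum) (m : Fin 2 → ℤ) (ψ : ℝ) :
    frameLevel μ K (S - levelPoint μ K 0 ψ) ≤ K₁ * ‖S - WithLp.toLp 2 (fun i => 2 * π * (m i : ℝ)) - (2 : ℝ) • levelPoint μ K 0 ψ‖ := by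
  set v : Momentum := WithLp.toLp 2 (fun i => 2 * π * (m i : ℝ)) with hv
  have h0 : frameLevel μ K (levelPoint μ K 0 ψ + v) = 0 := by
    rw [hv, frameLevel_add_twoPi]
    exact frameLevel_levelPoint_zero (bandBounds (show (-4 : ℝ) < -1.1 by norm_num) (show (-1.1 : ℝ) ≤ -0.1 by norm_num) (show (-0.1 : ℝ) < 0 by norm_num))
      hA hr hlo hhi ψ
  have hdiff : Differentiable ℝ (frameLevel μ K) := (EngineV8.contDiff_frameLevel μ K (n := 1)).differentiable one_ne_zero
  have h := (convex_univ (𝕜 := ℝ) (E := Momentum)).norm_image_sub_le_of_norm_fderiv_le (fun z _ => hdiff z) (fun z _ => hK₁ z)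
    (mem_univ (levelPoint μ K 0 ψ + v)) (mem_univ (S - levelPoint μ K 0 ψ))
  rw [h0, sub_zero, Real.norm_eq_abs] at h
  have hvec : S - levelPoint μ K 0 ψ - (levelPoint μ K 0 ψ + v) = S - v - (2 : ℝ) • levelPoint μ K 0 ψ := by rw [two_smul]; abel
  rw [hvec] at h
  exact (le_abs_self _).trans h

/-! ## §2 The primed pre-caustic level line of the partner band at one loop angle -/


omit hK₃ in
/-- **THE PRE-CAUSTIC LEVEL LINE OF THE PARTNER BAND, PRIMED** (HEADLINE; primed sibling of `…C4aFoldBoxPreLawLine.abs_levelLine_partnerBand_pre_le`).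
Same hypotheses and conclusion as the unprimed law EXCEPT: (L2′) the split support row is two-sided, `|u| ≤ q_s·e ⟹ (K e)′u = 0` with `q_s ≥ 3/2`; (L1′) the flatness
row at `D = e_K(S − Φ(0, y+θ))` carries an additive slot, `|∫ w·(K e)′(D − e)| ≤ A_fl·lo/max(D,lo)² + B_fl`, and the conclusion's constant term gains `+ X₀·B_fl`.
The conclusion is the `hF` row of `…C4aPreCausticAngleLayer.intervalIntegral_pre_caustic_angle_le` at the loop angle `y` with `A₁ = X₀·A_fl`,
`A₂ = 128Wκ²X₀(K₂/(Dt−2A))msD₁`, `A₃ = 64Wκ²X₀(K₂/(Dt−2A))(C₀ + 2κ/(Dt−2A)) + 4Wκ²X₁ + X₀·B_fl`, `κ = 1/(q_s + 1/2)`. -/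
theorem abs_levelLine_partnerBand_pre_le' {Kc r₀ g₀ w : ℝ} (hG : GeomConstants (frameLevel μ K) Kc r₀ g₀ w) (S : Momentum) (m : Fin 2 → ℤ) (θ : ℝ)
    {y vs Δ lo hi qs X₀ X₁ W Afl Bfl : ℝ} {Kr : ℝ → ℝ → ℝ} {X wt : ℝ → ℝ}
    (hcrit : deriv (fun x : ℝ => frameLevel μ K (S - levelPoint μ K 0 (x + θ))) vs = 0)
    (hδ₀ : 0 < frameLevel μ K (S - levelPoint μ K 0 (vs + θ)))
    (hmin : frameLevel μ K (S - levelPoint μ K 0 (vs + θ)) ≤ frameLevel μ K (S - levelPoint μ K 0 (y + θ)))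
    (hDist : ‖S - WithLp.toLp 2 (fun i => 2 * π * (m i : ℝ)) - (2 : ℝ) • levelPoint μ K 0 (vs + θ)‖ ≤ Δ) (hΔ : Δ ≤ 3 / 10)
    (hΔu : Δ ≤ (bandBounds (show (-4 : ℝ) < -1.1 by norm_num) (show (-1.1 : ℝ) ≤ -0.1 by norm_num) (show (-0.1 : ℝ) < 0 by norm_num)).umin) (hΔr : K₁ * Δ < r)
    (hlo0 : 0 < lo) (hlohi : lo ≤ hi) (hhir : hi < r) (hqs : 3 / 2 ≤ qs) (hX₁ : 0 ≤ X₁)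
    (hratey : ∀ s ∈ Icc 0 hi, K₂ * ‖S - WithLp.toLp 2 (fun i => 2 * π * (m i : ℝ)) - (2 : ℝ) • levelPoint μ K s (y + θ)‖ /
        ((bandBounds (show (-4 : ℝ) < -1.1 by norm_num) (show (-1.1 : ℝ) ≤ -0.1 by norm_num) (show (-0.1 : ℝ) < 0 by norm_num)).Dtmin - 2 * A) ≤ 1 / 2)
    (hK : ∀ e ∈ Icc lo hi, ContDiff ℝ 2 (Kr e)) (hK1 : ∀ e ∈ Icc lo hi, ∀ u, |deriv (Kr e) u| ≤ (max e |u|)⁻¹ ^ 2)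
    (hK2 : ∀ e ∈ Icc lo hi, ∀ u, |iteratedDeriv 2 (Kr e) u| ≤ (max e |u|)⁻¹ ^ 3)
    (hsupp : ∀ e ∈ Icc lo hi, ∀ u, |u| ≤ qs * e → deriv (Kr e) u = 0) (hKc : Continuous fun p : ℝ × ℝ => deriv (Kr p.1) p.2)
    (hflat : |∫ e in lo..hi, wt e * deriv (Kr e) (frameLevel μ K (S - levelPoint μ K 0 (y + θ)) - e)| ≤
      Afl * (lo / (max (frameLevel μ K (S - levelPoint μ K 0 (y + θ))) lo) ^ 2) + Bfl)
    (hwc : ContinuousOn wt (Icc lo hi)) (hw0 : ∀ e ∈ Icc lo hi, 0 ≤ wt e) (hwW : ∀ e ∈ Icc lo hi, wt e ≤ W)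
    (hXc : ContinuousOn X (Icc lo hi)) (hX0 : ∀ e ∈ Icc lo hi, |X e| ≤ X₀) (hXL : ∀ e ∈ Icc lo hi, |X e - X lo| ≤ X₁ * |e - lo|) :
    |∫ e in lo..hi, wt e * X e * deriv (Kr e) (frameLevel μ K (S - levelPoint μ K e (y + θ)))| ≤
      X₀ * Afl * (lo / (max (frameLevel μ K (S - levelPoint μ K 0 (y + θ))) lo) ^ 2) +
        128 * W * (1 / (qs + 1 / 2)) ^ 2 * X₀ *
              (K₂ / ((bandBounds (show (-4 : ℝ) < -1.1 by norm_num) (show (-1.1 : ℝ) ≤ -0.1 by norm_num) (show (-0.1 : ℝ) < 0 by norm_num)).Dtmin - 2 * A)) *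
            msD A₃ A₄ 1 *
          (|y - vs| / frameLevel μ K (S - levelPoint μ K 0 (y + θ))) +
        (64 * W * (1 / (qs + 1 / 2)) ^ 2 * X₀ *
              (K₂ / ((bandBounds (show (-4 : ℝ) < -1.1 by norm_num) (show (-1.1 : ℝ) ≤ -0.1 by norm_num) (show (-0.1 : ℝ) < 0 by norm_num)).Dtmin - 2 * A)) *
            ((1 / ((bandBounds (show (-4 : ℝ) < -1.1 by norm_num) (show (-1.1 : ℝ) ≤ -0.1 by norm_num) (show (-0.1 : ℝ) < 0 by norm_num)).Dtmin - 2 * A) +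
                msD A₃ A₄ 1 * (π * (4 + 2 * A) * Kc /
                  ((bandBounds (show (-4 : ℝ) < -1.1 by norm_num) (show (-1.1 : ℝ) ≤ -0.1 by norm_num) (show (-0.1 : ℝ) < 0 by norm_num)).umin * w *
                    ((bandBounds (show (-4 : ℝ) < -1.1 by norm_num) (show (-1.1 : ℝ) ≤ -0.1 by norm_num) (show (-0.1 : ℝ) < 0 by norm_num)).Dtmin - 2 * A) ^ 2))) +
              2 * (1 / (qs + 1 / 2)) /
                ((bandBounds (show (-4 : ℝ) < -1.1 by norm_num) (show (-1.1 : ℝ) ≤ -0.1 by norm_num) (show (-0.1 : ℝ) < 0 by norm_num)).Dtmin - 2 * A)) +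
          4 * W * (1 / (qs + 1 / 2)) ^ 2 * X₁ + X₀ * Bfl) := by
  set B := bandBounds (show (-4 : ℝ) < -1.1 by norm_num) (show (-1.1 : ℝ) ≤ -0.1 by norm_num) (show (-0.1 : ℝ) < 0 by norm_num) with hBdef
  set v : Momentum := WithLp.toLp 2 (fun i => 2 * π * (m i : ℝ)) with hv
  obtain ⟨D, hDdef⟩ : ∃ D : ℝ, D = frameLevel μ K (S - levelPoint μ K 0 (y + θ)) := ⟨_, rfl⟩
  obtain ⟨δ₀, hδ₀def⟩ : ∃ δ₀ : ℝ, δ₀ = frameLevel μ K (S - levelPoint μ K 0 (vs + θ)) := ⟨_, rfl⟩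
  rw [← hDdef] at hflat hmin ⊢
  rw [← hδ₀def] at hδ₀ hmin
  obtain ⟨κ, hκ⟩ : ∃ κ : ℝ, κ = 1 / (qs + 1 / 2) := ⟨_, rfl⟩
  obtain ⟨C₀, hC₀⟩ : ∃ C₀ : ℝ, C₀ = 1 / (B.Dtmin - 2 * A) + msD A₃ A₄ 1 * (π * (4 + 2 * A) * Kc / (B.umin * w * (B.Dtmin - 2 * A) ^ 2)) := ⟨_, rfl⟩
  rw [← hκ, ← hC₀]
  have hADt : 2 * A < B.Dtmin := by have := klCurveD_pos; linarith
  have hDt : 0 < B.Dtmin - 2 * A := by linarith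
  have hK₂0 : 0 ≤ K₂ := (norm_nonneg _).trans (hK₂ 0)
  have hA0 : 0 ≤ A := (norm_nonneg _).trans (hA 0 0 (by norm_num))
  have hKc0 : 0 ≤ Kc := (norm_nonneg _).trans (hG.norm_iteratedFDeriv_le 0 0 (by norm_num))
  have hu : 0 < B.umin := B.umin_pos
  have hwp : 0 < w := hG.wmin_pos
  have h0r : |(0 : ℝ)| < r := by rw [abs_zero]; exact hr
  have hM : 0 ≤ msD A₃ A₄ 1 := (norm_nonneg _).trans (norm_iteratedDeriv_levelPoint_le hA hA20 hd hlo hhi hA₃ hA₄ h0r le_rfl (by norm_num) 0)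
  have hC₀0 : 0 ≤ C₀ := by rw [hC₀]; positivity
  have hDpos : 0 < D := hδ₀.trans_le hmin
  have hqs0 : 0 < qs + 1 / 2 := by linarith
  have hκ0 : 0 < κ := by rw [hκ]; positivity
  have hκD : κ * D = D / (qs + 1 / 2) := by rw [hκ]; field_simp
  have hloI : lo ∈ Icc lo hi := left_mem_Icc.2 hlohi
  have hX00 : 0 ≤ X₀ := (abs_nonneg _).trans (hX0 lo hloI)
  have hW0 : 0 ≤ W := (hw0 lo hloI).trans (hwW lo hloI)
  -- the caustic distance at the fold point and at the angle `y`
  have hD5a : ‖S - v - (2 : ℝ) • levelPoint μ K 0 (vs + θ)‖ ≤ C₀ * δ₀ := by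
    have h := norm_caustic_le_of_foldPoint hA hA20 hd hr hlo hhi hA₃ hA₄ hK₁ hG S m θ hcrit hDist hΔ hΔu hΔr
    rw [← hδ₀def, abs_of_pos hδ₀, ← hv] at h
    rw [hC₀]; exact h
  have hDy : ‖S - v - (2 : ℝ) • levelPoint μ K 0 (y + θ)‖ ≤ C₀ * D + 2 * msD A₃ A₄ 1 * |y - vs| := by
    have h := norm_caustic_sub_two_smul_le hA hA20 hd hlo hhi hA₃ hA₄ S v h0r θ vs y
    rw [abs_zero, zero_div, zero_add] at h
    have h2 : C₀ * δ₀ ≤ C₀ * D := mul_le_mul_of_nonneg_left hmin hC₀0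
    linarith
  -- the two deformation rows
  have hdev : ∀ e ∈ Icc lo hi, |frameLevel μ K (S - levelPoint μ K e (y + θ)) - (D - e)| ≤ e / 2 := fun e he => by
    have he0 : 0 ≤ e := hlo0.le.trans he.1
    have h := abs_partnerBand_sub_antidiagonal_le_half hA hd hlo hhi hK₂ S m (y + θ) he0 (lt_of_le_of_lt he.2 hhir)
      (fun s hs => hratey s ⟨hs.1, hs.2.trans he.2⟩)
    rw [← hDdef] at h
    have e1 : frameLevel μ K (S - levelPoint μ K e (y + θ)) - (D - e) = frameLevel μ K (S - levelPoint μ K e (y + θ)) - D + e := by ring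
    rw [e1]; exact h
  obtain ⟨ρ, hρ⟩ : ∃ ρ : ℝ, ρ = K₂ / (B.Dtmin - 2 * A) * (C₀ * D + 2 * msD A₃ A₄ 1 * |y - vs| + 2 * (κ * D) / (B.Dtmin - 2 * A)) * (κ * D) := ⟨_, rfl⟩
  have hρ0 : 0 ≤ ρ := by rw [hρ]; positivity
  have hdevρ : ∀ e ∈ Icc lo hi, e ≤ D / (qs + 1 / 2) → |frameLevel μ K (S - levelPoint μ K e (y + θ)) - (D - e)| ≤ ρ := fun e he heκ => by
    have he0 : 0 ≤ e := hlo0.le.trans he.1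
    rw [← hκD] at heκ
    -- along `[0, e₁]`, `e₁ = min(κD, hi) < r`
    have he₁ : e ≤ min (κ * D) hi := le_min heκ he.2
    have he₁r : min (κ * D) hi < r := lt_of_le_of_lt (min_le_right _ _) hhir
    have h := abs_partnerBand_sub_antidiagonal_le hA hA20 hd hlo hhi hA₃ hA₄ hK₂ S m (y + θ) he0 he₁ he₁r
    rw [← hDdef, ← hv] at h
    have e1 : frameLevel μ K (S - levelPoint μ K e (y + θ)) - (D - e) = frameLevel μ K (S - levelPoint μ K e (y + θ)) - D + e := by ring
    rw [e1]
    refine h.trans ?_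
    rw [hρ]
    have hmn : 2 * min (κ * D) hi / (B.Dtmin - 2 * A) ≤ 2 * (κ * D) / (B.Dtmin - 2 * A) :=
      div_le_div_of_nonneg_right (by linarith [min_le_left (κ * D) hi]) hDt.le
    have h1 : ‖S - v - (2 : ℝ) • levelPoint μ K 0 (y + θ)‖ + 2 * min (κ * D) hi / (B.Dtmin - 2 * A) ≤
        C₀ * D + 2 * msD A₃ A₄ 1 * |y - vs| + 2 * (κ * D) / (B.Dtmin - 2 * A) := by linarith
    have h2 : 0 ≤ K₂ / (B.Dtmin - 2 * A) * (‖S - v - (2 : ℝ) • levelPoint μ K 0 (y + θ)‖ + 2 * min (κ * D) hi / (B.Dtmin - 2 * A)) := by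
      have : 0 ≤ min (κ * D) hi := le_min (by positivity) (hlo0.le.trans hlohi)
      positivity
    exact mul_le_mul (mul_le_mul_of_nonneg_left h1 (by positivity)) heκ he0 (by positivity)
  -- integrability of the two integrands (continuity)
  have hgc : ContinuousOn (fun e : ℝ => frameLevel μ K (S - levelPoint μ K e (y + θ))) (Icc lo hi) := fun e he =>
    (hasDerivAt_partnerBand_level hA hd hlo hhi S (abs_lt.2 ⟨by linarith [he.1], lt_of_le_of_lt he.2 hhir⟩) (y + θ)).continuousAt.continuousWithinAt
  have hfi : IntervalIntegrable (fun e => wt e * X e * deriv (Kr e) (frameLevel μ K (S - levelPoint μ K e (y + θ)))) volume lo hi := by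
    refine ContinuousOn.intervalIntegrable ?_
    rw [uIcc_of_le hlohi]
    exact (hwc.mul hXc).mul (hKc.comp_continuousOn (continuousOn_id.prodMk hgc))
  have hgi : IntervalIntegrable (fun e => wt e * deriv (Kr e) (D - e)) volume lo hi := by
    refine ContinuousOn.intervalIntegrable ?_
    rw [uIcc_of_le hlohi]
    exact hwc.mul (hKc.comp_continuousOn (continuousOn_id.prodMk (continuousOn_const.sub continuousOn_id)))
  -- the carrier-free level line with the split
  have hmain := abs_intervalIntegral_levelLine_split_abs_le (eb := fun e => frameLevel μ K (S - levelPoint μ K e (y + θ))) hlo0 hlohi hDpos hqs hX₁ hρ0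
    hK hK1 hK2 hsupp hflat hfi hgi hw0 hwW hX0 hXL hdev hdevρ
  refine hmain.trans ?_
  rw [← hκD]
  -- bookkeeping of the constants
  have hD0 : D ≠ 0 := hDpos.ne'
  have hterm1 : W * (X₀ * (64 / D ^ 3) * ρ) * (κ * D) =
      64 * W * κ ^ 2 * X₀ * (K₂ / (B.Dtmin - 2 * A)) * (C₀ + 2 * κ / (B.Dtmin - 2 * A)) +
        128 * W * κ ^ 2 * X₀ * (K₂ / (B.Dtmin - 2 * A)) * msD A₃ A₄ 1 * (|y - vs| / D) := by
    rw [hρ]; field_simp; ring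
  have hterm2 : W * (X₁ * (4 / D ^ 2) * (κ * D)) * (κ * D) = 4 * W * κ ^ 2 * X₁ := by field_simp
  have hsum : W * (X₀ * (64 / D ^ 3) * ρ + X₁ * (4 / D ^ 2) * (κ * D)) * (κ * D) =
      W * (X₀ * (64 / D ^ 3) * ρ) * (κ * D) + W * (X₁ * (4 / D ^ 2) * (κ * D)) * (κ * D) := by ring
  rw [hsum, hterm1, hterm2]
  linarith

end Sizes

end Summit.HubbardSuperconductivity.HubbardSuperconductivity.Theorems.C4a

end
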